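import Literature.Topology.FourManifolds.LefschetzBasePages
import Literature.Topology.FourManifolds.TorusKnotMilnorFibreHomology
import HarnessLib

/-!
# The standard Lefschetz base of genus `g`, VI: the overlap `U ∩ V` of the Milnor cover is
# `≃ₕ Fin 2 × Fin (2g+1)`

Topic `Literature/Topology/FourManifolds`; namespace `Literature.Topology.FourManifolds.LefschetzBase`.
Sequel of `LefschetzBaseCover.lean` (`U = {Re x^{2g+1} > −3/8} ≃ₕ Fin 2`, sheet sign `angU`) and
`LefschetzBaseCoverSectors.lean` (`V = {Re x^{2g+1} < −1/4} ≃ₕ Fin (2g+1)`, sector root `angV`),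
written so as not to import them (the sets are spelled out; the sheet sign, the sector root and the
bookkeeping lemmas are repeated as `private` copies, and `idxW_apply` records the index map in
closed form).  Everything here is PROVED; nothing is asserted.

* §12 on `U ∩ V` both the sheet sign `y/√(y²) ∈ {±1}` and the sector root (a `(2g+1)`-st root of
  unity) are locally constant; deforming `x^{2g+1}` linearly to `−5/16` and `w` to `0`,
  `(x, y) ↦ (angV · ν (−P_t)^{1/(2g+1)}, angU · √(P_t + 1 + t w))`, `P_t = −5/16 + t(x^{2g+1} + 5/16)`,
  deformation retracts `U ∩ V` onto the `2(2g+1)` points `(ν μ^k (5/16)^{1/(2g+1)}, ± √(11/16))`: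
  **`homotopyEquivW : U ∩ V ≃ₕ Fin 2 × Fin (2g+1)`** (Milnor 1968, Lemma 9.2; with `U ≃ₕ Fin 2`,
  `V ≃ₕ Fin (2g+1)` the Mayer–Vietoris count, Hatcher §2.2, gives `rank H₁(Base g; ℤ) = 2g`).

## References
* J. Milnor, *Singular points of complex hypersurfaces*, Ann. of Math. Studies 61 (1968), §9,
  Thm. 9.1, Lemma 9.2. [Milnor1968]
* A. Hatcher, *Algebraic Topology*, CUP 2002, §2.2 pp. 149–150 (Mayer–Vietoris). [HatcherAT2002]
-/

noncomputable section

open scoped Manifold ContDiff Topology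
open Set Function Metric
open Literature.Topology.FourManifolds.TorusKnotMilnor

namespace Literature.Topology.FourManifolds

/-- Local notation: `𝔼 n` is the model Euclidean space `EuclideanSpace ℝ (Fin n)`. -/
local notation "𝔼 " n:arg => EuclideanSpace ℝ (Fin n)

namespace LefschetzBase

variable {g : ℕ}

-- Local notation: the piece `U` (`coverU g` of `LefschetzBaseCover.lean`), written out.
set_option quotPrecheck false in
local notation "𝒰 " g:arg => ({p : Base g | -(3 / 8 : ℝ) < (cx p.1 ^ (2 * g + 1)).re} : Set (Base g))

-- Local notation: the piece `V` (`coverV g` of `LefschetzBaseCover.lean`), written out.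
set_option quotPrecheck false in
local notation "𝒱 " g:arg => ({p : Base g | (cx p.1 ^ (2 * g + 1)).re < -(1 / 4 : ℝ)} : Set (Base g))

/-! ## §12a Private copies (bookkeeping, sheet sign on `U`, sector root on `V`) -/

/-- `x^{2g+1}` is continuous on the base. [folklore] -/
private theorem continuous_xPow (g : ℕ) : Continuous fun p : Base g => cx p.1 ^ (2 * g + 1) :=
  (contDiff_cx.continuous.comp continuous_subtype_val).pow _
/-- `rho` in complex coordinates. [folklore] -/
private theorem rho_mk' (g : ℕ) (a b : ℂ) :
    rho g (mk a b) = ‖b ^ 2 - a ^ (2 * g + 1) - 1‖ ^ 2 + eta (‖a‖ ^ 2) := by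
  simp only [rho, w, Phi, cx_mk, cy_mk]
/-- `w = y² − x^{2g+1} − 1`. [folklore] -/
private theorem w_eq' (g : ℕ) (q : 𝔼 4) : w g q = cy q ^ 2 - cx q ^ (2 * g + 1) - 1 := rfl
/-- `y² = x^{2g+1} + 1 + w`. [folklore] -/
private theorem cy_sq_eq (g : ℕ) (q : 𝔼 4) : cy q ^ 2 = cx q ^ (2 * g + 1) + 1 + w g q := by
  rw [w_eq']; ring
/-- On the base `‖w‖ ≤ 1/2`. [folklore] -/
private theorem norm_w_le (p : Base g) : ‖w g p.1‖ ≤ 1 / 2 := by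
  nlinarith [(bounds_of_rho_le g p.2).2, norm_nonneg (w g p.1)]
/-- `eta` bookkeeping: if `‖a'‖^{n+1} ≤ max 1 ‖a‖^{n+1}` then `eta ‖a'‖² ≤ eta ‖a‖²` (`eta` is (private copy) [folklore] -/
private theorem eta_le_of_pow_le {a b : ℝ} (ha : 0 ≤ a) (hb : 0 ≤ b) {n : ℕ}
    (h : a ^ (n + 1) ≤ max 1 (b ^ (n + 1))) : eta (a ^ 2) ≤ eta (b ^ 2) := by
  rcases le_total 1 b with hb1 | hb1
  · rw [max_eq_right (one_le_pow₀ hb1)] at h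
    have hab : a ≤ b := le_of_pow_le_pow_left₀ (Nat.succ_ne_zero n) hb h
    exact eta_monotone (by nlinarith)
  · rw [max_eq_left (pow_le_one₀ hb hb1)] at h
    have ha1 : a ≤ 1 := le_of_pow_le_pow_left₀ (Nat.succ_ne_zero n) zero_le_one (by rwa [one_pow])
    rw [eta_of_le (by nlinarith)]
    exact eta_nonneg _
/-- A convex combination of `1` and `c ≥ 0` is at most `max 1 c`. [folklore] -/
private theorem convex_comb_le_max {s c : ℝ} (hs0 : 0 ≤ s) (hs1 : s ≤ 1) :
    (1 - s) + s * c ≤ max 1 c := by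
  rcases le_total 1 c with h | h
  · rw [max_eq_right h]; nlinarith
  · rw [max_eq_left h]; nlinarith
/-- **Staying in the base.**  If `p = (x, y) ∈ Base g` and `(a', b')` has thickening parameter (private copy) [folklore] -/
private theorem mk_mem_base (p : Base g) {a' b' : ℂ} {t : ℝ} (ht0 : 0 ≤ t) (ht1 : t ≤ 1)
    (hw : b' ^ 2 - a' ^ (2 * g + 1) - 1 = (t : ℂ) * w g p.1)
    (ha : ‖a'‖ ^ (2 * g + 1) ≤ max 1 (‖cx p.1‖ ^ (2 * g + 1))) :
    mk a' b' ∈ rho g ⁻¹' Iic (1 / 4 : ℝ) := by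
  have hp : rho g p.1 ≤ 1 / 4 := p.2
  rw [mem_preimage, mem_Iic, rho_mk', hw, norm_mul, Complex.norm_real, Real.norm_eq_abs,
    abs_of_nonneg ht0, mul_pow]
  have h1 : t ^ 2 * ‖w g p.1‖ ^ 2 ≤ ‖w g p.1‖ ^ 2 :=
    mul_le_of_le_one_left (sq_nonneg _) (pow_le_one₀ ht0 ht1)
  have h2 : eta (‖a'‖ ^ 2) ≤ eta (‖cx p.1‖ ^ 2) := eta_le_of_pow_le (norm_nonneg _) (norm_nonneg _) ha
  have h3 : rho g p.1 = ‖w g p.1‖ ^ 2 + eta (‖cx p.1‖ ^ 2) := rfl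
  linarith
/-- `√z ≠ 0` for `z ≠ 0`. [folklore] -/
private theorem csqrt_ne_zero {z : ℂ} (hz : z ≠ 0) : csqrt z ≠ 0 := fun h => by
  have := csqrt_sq z; rw [h, zero_pow two_ne_zero] at this; exact hz this.symm
/-- The square root is continuous on the open right half-plane. [folklore] -/
private theorem continuousOn_csqrt : ContinuousOn csqrt {z : ℂ | 0 < z.re} := fun _ hz =>
  (continuousAt_csqrt (le_of_lt hz)).continuousWithinAt
/-- On `U`, `Re y² > 1/8 > 0` (`y² = x^{2g+1} + 1 + w`, `‖w‖ ≤ 1/2`). [folklore] -/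
private theorem re_cy_sq_gt (p : ↥(𝒰 g)) : 1 / 8 < (cy p.1.1 ^ 2).re := by
  have h1 : -(3 / 8 : ℝ) < (cx p.1.1 ^ (2 * g + 1)).re := p.2
  have h2 : |(w g p.1.1).re| ≤ 1 / 2 := (Complex.abs_re_le_norm _).trans (norm_w_le p.1)
  rw [cy_sq_eq g, Complex.add_re, Complex.add_re, Complex.one_re]
  change 1 / 8 < (cx p.1.1 ^ (2 * g + 1)).re + 1 + (w g p.1.1).re
  linarith [neg_abs_le (w g p.1.1).re]
/-- On `U`, `y² ≠ 0`. [folklore] -/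
private theorem cy_sq_ne_zero (p : ↥(𝒰 g)) : cy p.1.1 ^ 2 ≠ 0 := fun h => by
  have := re_cy_sq_gt p; rw [h, Complex.zero_re] at this; linarith
/-- **The sheet sign `angU = y / √(y²) ∈ {±1}` on `U`.** [folklore] -/
private def angU (p : ↥(𝒰 g)) : ℂ := cy p.1.1 / csqrt (cy p.1.1 ^ 2)
/-- `angU² = 1`. [folklore] -/
private theorem angU_pow (p : ↥(𝒰 g)) : angU p ^ 2 = 1 := by
  rw [angU, div_pow, csqrt_sq, div_self (cy_sq_ne_zero p)]
/-- `y = angU · √(y²)` on `U`. [folklore] -/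
private theorem cy_eq_angU_mul (p : ↥(𝒰 g)) : cy p.1.1 = angU p * csqrt (cy p.1.1 ^ 2) := by
  rw [angU, div_mul_cancel₀ _ (csqrt_ne_zero (cy_sq_ne_zero p))]
/-- The sheet sign is continuous. [folklore] -/
private theorem continuous_angU : Continuous (angU (g := g)) := by
  have h1 : Continuous fun p : ↥(𝒰 g) => cy p.1.1 :=
    contDiff_cy.continuous.comp (continuous_subtype_val.comp continuous_subtype_val)
  have h2 : Continuous fun p : ↥(𝒰 g) => csqrt (cy p.1.1 ^ 2) :=
    continuousOn_csqrt.comp_continuous (h1.pow 2) fun p => lt_trans (by norm_num) (re_cy_sq_gt p)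
  exact h1.div h2 fun p => csqrt_ne_zero (cy_sq_ne_zero p)
/-- **The index map `U → Fin 2`.** [folklore] -/
private def idxU : C(↥(𝒰 g), Fin 2) :=
  ⟨fun p => rootIdx two_ne_zero (angU p), continuous_rootIdx_comp two_ne_zero continuous_angU angU_pow⟩
/-- `2g + 1 ≠ 0`. [folklore] -/
private theorem odd_ne_zero (g : ℕ) : 2 * g + 1 ≠ 0 := Nat.succ_ne_zero _
/-- On `V`, `Re (−x^{2g+1}) > 1/4 > 0`. [folklore] -/
private theorem re_neg_xPow_gt (p : ↥(𝒱 g)) : 1 / 4 < (-cx p.1.1 ^ (2 * g + 1)).re := by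
  have h : (cx p.1.1 ^ (2 * g + 1)).re < -(1 / 4 : ℝ) := p.2
  rw [Complex.neg_re]; linarith
/-- On `V`, `x^{2g+1} ≠ 0`. [folklore] -/
private theorem xPow_ne_zero (p : ↥(𝒱 g)) : cx p.1.1 ^ (2 * g + 1) ≠ 0 := fun h => by
  have := re_neg_xPow_gt p; rw [h, neg_zero, Complex.zero_re] at this; linarith
/-- The denominator `ν (−x^{2g+1})^{1/(2g+1)}` does not vanish on `V`. [folklore] -/
private theorem denV_ne_zero (p : ↥(𝒱 g)) : halfRoot (2 * g + 1) * prRoot (2 * g + 1) (-cx p.1.1 ^ (2 * g + 1)) ≠ 0 :=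
  mul_ne_zero (halfRoot_ne_zero _) (prRoot_ne_zero (odd_ne_zero g) (neg_ne_zero.2 (xPow_ne_zero p)))
/-- `(ν (−x^{2g+1})^{1/(2g+1)})^{2g+1} = x^{2g+1}`. [folklore] -/
private theorem denV_pow (p : ↥(𝒱 g)) :
    (halfRoot (2 * g + 1) * prRoot (2 * g + 1) (-cx p.1.1 ^ (2 * g + 1))) ^ (2 * g + 1) = cx p.1.1 ^ (2 * g + 1) := by
  rw [mul_pow, halfRoot_pow (odd_ne_zero g), prRoot_pow (odd_ne_zero g)]; ring
/-- **The sector root `angV = x / (ν (−x^{2g+1})^{1/(2g+1)})` on `V`**, a `(2g+1)`-st root of (private copy) [folklore] -/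
private def angV (p : ↥(𝒱 g)) : ℂ := cx p.1.1 / (halfRoot (2 * g + 1) * prRoot (2 * g + 1) (-cx p.1.1 ^ (2 * g + 1)))
/-- `angV^{2g+1} = 1`. [folklore] -/
private theorem angV_pow (p : ↥(𝒱 g)) : angV p ^ (2 * g + 1) = 1 := by
  rw [angV, div_pow, denV_pow, div_self (xPow_ne_zero p)]
/-- `x = angV · ν (−x^{2g+1})^{1/(2g+1)}` on `V`. [folklore] -/
private theorem cx_eq_angV_mul (p : ↥(𝒱 g)) :
    cx p.1.1 = angV p * (halfRoot (2 * g + 1) * prRoot (2 * g + 1) (-cx p.1.1 ^ (2 * g + 1))) := by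
  rw [angV, div_mul_cancel₀ _ (denV_ne_zero p)]
/-- The sector root is continuous. [folklore] -/
private theorem continuous_angV : Continuous (angV (g := g)) := by
  have h1 : Continuous fun p : ↥(𝒱 g) => cx p.1.1 :=
    contDiff_cx.continuous.comp (continuous_subtype_val.comp continuous_subtype_val)
  have h2 : Continuous fun p : ↥(𝒱 g) => prRoot (2 * g + 1) (-cx p.1.1 ^ (2 * g + 1)) :=
    (continuousOn_prRoot _).comp_continuous ((continuous_xPow g).comp continuous_subtype_val).neg fun p =>
      lt_trans (by norm_num) (re_neg_xPow_gt p)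
  exact h1.div (continuous_const.mul h2) denV_ne_zero
/-- **The index map `V → Fin (2g+1)`.** [folklore] -/
private def idxV : C(↥(𝒱 g), Fin (2 * g + 1)) :=
  ⟨fun p => rootIdx (odd_ne_zero g) (angV p),
    continuous_rootIdx_comp (odd_ne_zero g) continuous_angV angV_pow⟩
/-- `(ν μ^k)^{2g+1} = −1`. [folklore] -/
private theorem basePtV_pow (g k : ℕ) : (halfRoot (2 * g + 1) * rootU (2 * g + 1) ^ k) ^ (2 * g + 1) = -1 := by
  rw [mul_pow, halfRoot_pow (odd_ne_zero g), rootU_pow_pow (odd_ne_zero g), mul_one]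

/-! ## §12 The overlap `U ∩ V` deformation retracts onto `2(2g+1)` points -/

/-- A point of `U ∩ V`, as a point of `U`. [folklore] -/
def ovU (p : ↥(𝒰 g ∩ 𝒱 g)) : ↥(𝒰 g) := ⟨p.1, p.2.1⟩

/-- A point of `U ∩ V`, as a point of `V`. [folklore] -/
def ovV (p : ↥(𝒰 g ∩ 𝒱 g)) : ↥(𝒱 g) := ⟨p.1, p.2.2⟩

/-- **The index map `U ∩ V → Fin 2 × Fin (2g+1)`** (sheet sign, sector root). [folklore] -/
def idxW : C(↥(𝒰 g ∩ 𝒱 g), Fin 2 × Fin (2 * g + 1)) :=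
  ⟨fun p => (idxU (ovU p), idxV (ovV p)),
    (idxU.continuous.comp (continuous_subtype_val.subtype_mk _)).prodMk
      (idxV.continuous.comp (continuous_subtype_val.subtype_mk _))⟩

/-- **The index map in closed form**: the exponents of the sheet sign `y/√(y²) = (−1)^j` and of
the sector root `x / (ν (−x^{2g+1})^{1/(2g+1)}) = μ^k`. [folklore] -/
theorem idxW_apply (p : ↥(𝒰 g ∩ 𝒱 g)) : idxW p =
    (rootIdx two_ne_zero (cy p.1.1 / csqrt (cy p.1.1 ^ 2)),
      rootIdx (odd_ne_zero g) (cx p.1.1 / (halfRoot (2 * g + 1) * prRoot (2 * g + 1) (-(cx p.1.1 ^ (2 * g + 1)))))) :=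
  rfl

/-- The `x`-coordinate `ν μ^k (5/16)^{1/(2g+1)}` of the base point `(j, k)` of `U ∩ V` has
`x^{2g+1} = −5/16`. [folklore] -/
theorem basePtW_xpow (g k : ℕ) :
    (halfRoot (2 * g + 1) * rootU (2 * g + 1) ^ k * prRoot (2 * g + 1) (5 / 16)) ^ (2 * g + 1) = -(5 / 16) := by
  rw [mul_pow, basePtV_pow, prRoot_pow (odd_ne_zero g)]; ring

/-- The base point `(ν μ^k (5/16)^{1/(2g+1)}, μ₂^j √(11/16))` of `U ∩ V` lies in the base
(`w = 0`, `‖x‖ ≤ 1`). [folklore] -/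
theorem basePtW_mem (g j k : ℕ) :
    mk (halfRoot (2 * g + 1) * rootU (2 * g + 1) ^ k * prRoot (2 * g + 1) (5 / 16)) (rootU 2 ^ j * csqrt (11 / 16)) ∈
      rho g ⁻¹' Iic (1 / 4 : ℝ) := by
  have hw : w g (mk (halfRoot (2 * g + 1) * rootU (2 * g + 1) ^ k * prRoot (2 * g + 1) (5 / 16))
      (rootU 2 ^ j * csqrt (11 / 16))) = 0 := by
    rw [w_eq', cx_mk, cy_mk, basePtW_xpow, mul_pow, rootU_pow_pow two_ne_zero, csqrt_sq]; norm_num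
  rw [mem_preimage, mem_Iic, rho_eq_zero_of_w_eq_zero g hw]
  · norm_num
  · rw [cx_mk]
    have h : ‖halfRoot (2 * g + 1) * rootU (2 * g + 1) ^ k * prRoot (2 * g + 1) (5 / 16)‖ ^ (2 * g + 1) ≤ 1 := by
      rw [← norm_pow, basePtW_xpow, norm_neg]; norm_num
    have h1 : ‖halfRoot (2 * g + 1) * rootU (2 * g + 1) ^ k * prRoot (2 * g + 1) (5 / 16)‖ ≤ 1 :=
      le_of_pow_le_pow_left₀ (odd_ne_zero g) zero_le_one (by rwa [one_pow])
    nlinarith [norm_nonneg (halfRoot (2 * g + 1) * rootU (2 * g + 1) ^ k * prRoot (2 * g + 1) (5 / 16))]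

/-- The base points lie in `U ∩ V` (`Re x^{2g+1} = −5/16`). [folklore] -/
theorem basePtW_mem_inter (g j k : ℕ) :
    (⟨_, basePtW_mem g j k⟩ : Base g) ∈ 𝒰 g ∩ 𝒱 g := by
  constructor
  · show -(3 / 8 : ℝ) < (cx (mk _ _) ^ (2 * g + 1)).re
    rw [cx_mk, basePtW_xpow]; norm_num
  · show (cx (mk _ _) ^ (2 * g + 1)).re < -(1 / 4 : ℝ)
    rw [cx_mk, basePtW_xpow]; norm_num

/-- **The section `Fin 2 × Fin (2g+1) → U ∩ V`.** [folklore] -/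
def secW (g : ℕ) : C(Fin 2 × Fin (2 * g + 1), ↥(𝒰 g ∩ 𝒱 g)) :=
  ⟨fun jk => ⟨⟨_, basePtW_mem g jk.1 jk.2⟩, basePtW_mem_inter g jk.1 jk.2⟩, continuous_of_discreteTopology⟩

/-- The sheet sign of the base point `(j, k)` is `μ₂^j`. [folklore] -/
private theorem angU_secW (jk : Fin 2 × Fin (2 * g + 1)) : angU (ovU (secW g jk)) = rootU 2 ^ (jk.1 : ℕ) := by
  rw [angU]
  show cy (mk _ _) / csqrt (cy (mk _ _) ^ 2) = _
  rw [cy_mk, mul_pow, rootU_pow_pow two_ne_zero, one_mul, csqrt_sq, mul_div_cancel_right₀ _ (csqrt_ne_zero (by norm_num))]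

/-- The sector root of the base point `(j, k)` is `μ^k`. [folklore] -/
private theorem angV_secW (jk : Fin 2 × Fin (2 * g + 1)) : angV (ovV (secW g jk)) = rootU (2 * g + 1) ^ (jk.2 : ℕ) := by
  rw [angV]
  show cx (mk _ _) / (halfRoot (2 * g + 1) * prRoot (2 * g + 1) (-(cx (mk _ _) ^ (2 * g + 1)))) = _
  rw [cx_mk, basePtW_xpow, neg_neg, mul_assoc, mul_comm (rootU _ ^ _), ← mul_assoc,
    mul_div_cancel_left₀ _ (mul_ne_zero (halfRoot_ne_zero _) (prRoot_ne_zero (odd_ne_zero g) (by norm_num)))]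

/-- `idx ∘ sec = id` on `U ∩ V`. [folklore] -/
theorem idxW_secW (jk : Fin 2 × Fin (2 * g + 1)) : idxW (secW g jk) = jk := by
  show (rootIdx two_ne_zero (angU (ovU (secW g jk))), rootIdx (odd_ne_zero g) (angV (ovV (secW g jk)))) = jk
  rw [angU_secW, angV_secW, rootIdx_rootU_pow, rootIdx_rootU_pow]

/-- The interpolated value `P_t = −5/16 + t (x^{2g+1} + 5/16)` of `x^{2g+1}` along the deformation of
`U ∩ V`. [folklore] -/
def midP (t : ℝ) (p : ↥(𝒰 g ∩ 𝒱 g)) : ℂ := -(5 / 16) + (t : ℂ) * (cx p.1.1 ^ (2 * g + 1) + 5 / 16)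

/-- `Re P_t ∈ (−3/8, −1/4)` for `t ∈ [0, 1]`. [folklore] -/
theorem re_midP_mem {t : ℝ} (ht0 : 0 ≤ t) (ht1 : t ≤ 1) (p : ↥(𝒰 g ∩ 𝒱 g)) :
    -(3 / 8 : ℝ) < (midP t p).re ∧ (midP t p).re < -(1 / 4 : ℝ) := by
  have hU : -(3 / 8 : ℝ) < (cx p.1.1 ^ (2 * g + 1)).re := p.2.1
  have hV : (cx p.1.1 ^ (2 * g + 1)).re < -(1 / 4 : ℝ) := p.2.2
  have hre : (midP t p).re = -(5 / 16) + t * ((cx p.1.1 ^ (2 * g + 1)).re + 5 / 16) := by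
    simp [midP]
  rw [hre]
  constructor <;> nlinarith

/-- `‖P_t‖ ≤ max 1 ‖x‖^{2g+1}`. [folklore] -/
theorem norm_midP_le {t : ℝ} (ht0 : 0 ≤ t) (ht1 : t ≤ 1) (p : ↥(𝒰 g ∩ 𝒱 g)) :
    ‖midP t p‖ ≤ max 1 (‖cx p.1.1‖ ^ (2 * g + 1)) := by
  calc ‖midP t p‖ = ‖(((1 - t) * -(5 / 16) : ℝ) : ℂ) + (t : ℂ) * cx p.1.1 ^ (2 * g + 1)‖ := by
        rw [midP]; congr 1; push_cast; ring
    _ ≤ (1 - t) * (5 / 16) + t * ‖cx p.1.1‖ ^ (2 * g + 1) := by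
        refine (norm_add_le _ _).trans ?_
        rw [Complex.norm_real, Real.norm_eq_abs, norm_mul, Complex.norm_real, Real.norm_eq_abs, abs_of_nonneg ht0,
          norm_pow, show |(1 - t) * -(5 / 16 : ℝ)| = (1 - t) * (5 / 16) by
            rw [abs_mul, abs_of_nonneg (by linarith), abs_neg, abs_of_pos (by norm_num)]]
    _ ≤ (1 - t) + t * ‖cx p.1.1‖ ^ (2 * g + 1) := by nlinarith
    _ ≤ max 1 (‖cx p.1.1‖ ^ (2 * g + 1)) := convex_comb_le_max ht0 ht1

/-- **The deformation of `U ∩ V`**: `(x, y) ↦ (angV · ν (−P_t)^{1/(2g+1)}, angU · √(P_t + 1 + t w))`.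
[cite: Milnor1968, §9 Lemma 9.2] -/
def defW (t : ℝ) (p : ↥(𝒰 g ∩ 𝒱 g)) : 𝔼 4 :=
  mk (angV (ovV p) * (halfRoot (2 * g + 1) * prRoot (2 * g + 1) (-midP t p)))
    (angU (ovU p) * csqrt (midP t p + 1 + (t : ℂ) * w g p.1.1))

/-- Along the deformation `x^{2g+1} = P_t`. [folklore] -/
private theorem defW_xpow (t : ℝ) (p : ↥(𝒰 g ∩ 𝒱 g)) :
    (angV (ovV p) * (halfRoot (2 * g + 1) * prRoot (2 * g + 1) (-midP t p))) ^ (2 * g + 1) = midP t p := by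
  rw [mul_pow, angV_pow, one_mul, mul_pow, halfRoot_pow (odd_ne_zero g), prRoot_pow (odd_ne_zero g)]; ring

/-- Along the deformation the radicand has `Re > 1/8`. [folklore] -/
theorem re_radW_gt {t : ℝ} (ht0 : 0 ≤ t) (ht1 : t ≤ 1) (p : ↥(𝒰 g ∩ 𝒱 g)) :
    1 / 8 < (midP t p + 1 + (t : ℂ) * w g p.1.1).re := by
  have h1 := (re_midP_mem ht0 ht1 p).1
  have h2 : |(w g p.1.1).re| ≤ 1 / 2 := (Complex.abs_re_le_norm _).trans (norm_w_le p.1)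
  rw [Complex.add_re, Complex.add_re, Complex.one_re, Complex.re_ofReal_mul]
  have h3 : -(1 / 2 : ℝ) ≤ t * (w g p.1.1).re := by
    rcases le_or_gt 0 (w g p.1.1).re with h | h
    · nlinarith
    · nlinarith [neg_abs_le (w g p.1.1).re]
  linarith

/-- The deformation stays in the base. [folklore] -/
theorem defW_mem {t : ℝ} (ht0 : 0 ≤ t) (ht1 : t ≤ 1) (p : ↥(𝒰 g ∩ 𝒱 g)) :
    defW t p ∈ rho g ⁻¹' Iic (1 / 4 : ℝ) := by
  refine mk_mem_base p.1 ht0 ht1 ?_ ?_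
  · rw [mul_pow (angU _), angU_pow, one_mul, csqrt_sq, defW_xpow]; ring
  · rw [← norm_pow, defW_xpow]; exact norm_midP_le ht0 ht1 p

/-- The deformation stays in `U ∩ V`. [folklore] -/
theorem defW_mem_inter {t : ℝ} (ht0 : 0 ≤ t) (ht1 : t ≤ 1) (p : ↥(𝒰 g ∩ 𝒱 g)) :
    (⟨defW t p, defW_mem ht0 ht1 p⟩ : Base g) ∈ 𝒰 g ∩ 𝒱 g := by
  have h := re_midP_mem ht0 ht1 p
  have hP : (cx (defW t p) ^ (2 * g + 1)).re = (midP t p).re := by rw [defW, cx_mk, defW_xpow]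
  exact ⟨show -(3 / 8 : ℝ) < (cx (defW t p) ^ (2 * g + 1)).re from hP ▸ h.1,
    show (cx (defW t p) ^ (2 * g + 1)).re < -(1 / 4 : ℝ) from hP ▸ h.2⟩

/-- The deformation as a map `[0,1] × (U ∩ V) → U ∩ V`. [folklore] -/
def defWMap (z : unitInterval × ↥(𝒰 g ∩ 𝒱 g)) : ↥(𝒰 g ∩ 𝒱 g) :=
  ⟨⟨defW z.1 z.2, defW_mem z.1.2.1 z.1.2.2 z.2⟩, defW_mem_inter z.1.2.1 z.1.2.2 z.2⟩

/-- The deformation is continuous. [folklore] -/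
theorem continuous_defWMap : Continuous (defWMap (g := g)) := by
  refine Continuous.subtype_mk (Continuous.subtype_mk ?_ _) _
  have hs : Continuous fun z : unitInterval × ↥(𝒰 g ∩ 𝒱 g) => ((z.1 : ℝ) : ℂ) :=
    Complex.continuous_ofReal.comp (continuous_subtype_val.comp continuous_fst)
  have hw : Continuous fun z : unitInterval × ↥(𝒰 g ∩ 𝒱 g) => w g z.2.1.1 :=
    (contDiff_w g).continuous.comp (continuous_subtype_val.comp (continuous_subtype_val.comp continuous_snd))
  have hP : Continuous fun z : unitInterval × ↥(𝒰 g ∩ 𝒱 g) => cx z.2.1.1 ^ (2 * g + 1) :=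
    (continuous_xPow g).comp (continuous_subtype_val.comp continuous_snd)
  have hmid : Continuous fun z : unitInterval × ↥(𝒰 g ∩ 𝒱 g) => midP (z.1 : ℝ) z.2 :=
    continuous_const.add (hs.mul (hP.add continuous_const))
  have hroot1 : Continuous fun z : unitInterval × ↥(𝒰 g ∩ 𝒱 g) => prRoot (2 * g + 1) (-midP (z.1 : ℝ) z.2) :=
    (continuousOn_prRoot _).comp_continuous hmid.neg fun z => by
      have h := (re_midP_mem z.1.2.1 z.1.2.2 z.2).2
      show 0 < (-midP (z.1 : ℝ) z.2).re
      rw [Complex.neg_re]; linarith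
  have hroot2 : Continuous fun z : unitInterval × ↥(𝒰 g ∩ 𝒱 g) =>
      csqrt (midP (z.1 : ℝ) z.2 + 1 + ((z.1 : ℝ) : ℂ) * w g z.2.1.1) :=
    continuousOn_csqrt.comp_continuous ((hmid.add continuous_const).add (hs.mul hw)) fun z =>
      lt_trans (by norm_num) (re_radW_gt z.1.2.1 z.1.2.2 z.2)
  have hangU : Continuous fun z : unitInterval × ↥(𝒰 g ∩ 𝒱 g) => angU (ovU z.2) :=
    continuous_angU.comp ((continuous_subtype_val.subtype_mk _).comp continuous_snd)
  have hangV : Continuous fun z : unitInterval × ↥(𝒰 g ∩ 𝒱 g) => angV (ovV z.2) :=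
    continuous_angV.comp ((continuous_subtype_val.subtype_mk _).comp continuous_snd)
  exact continuous_mk.comp ((hangV.mul (continuous_const.mul hroot1)).prodMk (hangU.mul hroot2))

/-- At `t = 1`, `P_t = x^{2g+1}` and the deformation is the identity. [folklore] -/
theorem defW_one (p : ↥(𝒰 g ∩ 𝒱 g)) : defW 1 p = p.1.1 := by
  have hmid : midP 1 p = cx p.1.1 ^ (2 * g + 1) := by rw [midP, Complex.ofReal_one, one_mul]; ring
  rw [defW, hmid, Complex.ofReal_one, one_mul]
  have hx : angV (ovV p) * (halfRoot (2 * g + 1) * prRoot (2 * g + 1) (-cx p.1.1 ^ (2 * g + 1))) = cx p.1.1 :=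
    (cx_eq_angV_mul (ovV p)).symm
  have hy : angU (ovU p) * csqrt (cx p.1.1 ^ (2 * g + 1) + 1 + w g p.1.1) = cy p.1.1 := by
    rw [← cy_sq_eq]; exact (cy_eq_angU_mul (ovU p)).symm
  rw [hx, hy]
  exact mk_cx_cy p.1.1

/-- At `t = 0`, `P_t = −5/16` and the deformation is the base point `sec (idx p)`. [folklore] -/
theorem defW_zero (p : ↥(𝒰 g ∩ 𝒱 g)) : defW 0 p = (secW g (idxW p)).1.1 := by
  have hmid : midP 0 p = -(5 / 16) := by rw [midP, Complex.ofReal_zero, zero_mul, add_zero]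
  rw [defW, hmid, neg_neg, Complex.ofReal_zero, zero_mul, add_zero,
    show (-(5 / 16) + 1 : ℂ) = 11 / 16 by norm_num]
  show mk (angV (ovV p) * (halfRoot (2 * g + 1) * prRoot (2 * g + 1) (5 / 16))) (angU (ovU p) * csqrt (11 / 16)) =
    mk (halfRoot (2 * g + 1) * rootU (2 * g + 1) ^ (rootIdx (odd_ne_zero g) (angV (ovV p)) : ℕ) *
        prRoot (2 * g + 1) (5 / 16)) (rootU 2 ^ (rootIdx two_ne_zero (angU (ovU p)) : ℕ) * csqrt (11 / 16))
  rw [rootU_pow_rootIdx (odd_ne_zero g) (angV_pow _), rootU_pow_rootIdx two_ne_zero (angU_pow _)]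
  congr 1; ring

/-- **The homotopy `id_{U ∩ V} ≃ sec ∘ idx`.** [cite: Milnor1968, §9 Lemma 9.2] -/
def homotopyW (g : ℕ) : ContinuousMap.Homotopy (ContinuousMap.id ↥(𝒰 g ∩ 𝒱 g)) ((secW g).comp idxW) where
  toFun z := defWMap (unitInterval.symm z.1, z.2)
  continuous_toFun := continuous_defWMap.comp
    ((unitInterval.continuous_symm.comp continuous_fst).prodMk continuous_snd)
  map_zero_left p := by
    apply Subtype.ext; apply Subtype.ext
    show defW (unitInterval.symm 0 : ℝ) p = p.1.1
    rw [unitInterval.symm_zero, Set.Icc.coe_one, defW_one]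
  map_one_left p := by
    apply Subtype.ext; apply Subtype.ext
    show defW (unitInterval.symm 1 : ℝ) p = (secW g (idxW p)).1.1
    rw [unitInterval.symm_one, Set.Icc.coe_zero, defW_zero]

/-- **`U ∩ V ≃ Fin 2 × Fin (2g+1)`**: the overlap is homotopy equivalent to `2(2g+1)` points.
[cite: Milnor1968, §9 Lemma 9.2] -/
def homotopyEquivW (g : ℕ) : ContinuousMap.HomotopyEquiv ↥(𝒰 g ∩ 𝒱 g) (Fin 2 × Fin (2 * g + 1)) where
  toFun := idxW
  invFun := secW g
  left_inv := ⟨(homotopyW g).symm⟩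
  right_inv := by
    rw [show idxW.comp (secW g) = ContinuousMap.id (Fin 2 × Fin (2 * g + 1)) from ContinuousMap.ext idxW_secW]

end LefschetzBase

end Literature.Topology.FourManifolds
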